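import Summits.QuantumFields.YangMills.Theorems.IR.BetaSlopeFloorTransportSignFree

/-!
# Line `beta-slope-floor` (crux `IR`, stmt-QuantumFields-19354): transport of a GUARDED running slope floor

Route `BalabanLadder`, crux `IR`, line `beta-slope-floor` (ideator ym-ir-idea-2), lead prover `ym-ir-line-bsf-p1` (g4).
The line's XL load through v5.1 (`ReflSlopeFloor`) asks the running floor `(c·a(b)·S − K_A)·R_b ≤ ∂_b R_b` for the two
reflected antipodal clauses of EVERY species at EVERY point of the unit window — also where the clause is NEGATIVE.
That is an over-statement: for a species whose reflected antipodal clause is eventually negative, `R_b = −ε_b`,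
`ε_b ≍ e^{−M_A(b) S}` with the asymptotically-free sign `∂_b M_A < 0`, the unguarded inequality reads
`ε_b'/ε_b ≤ c·a(b)·S − K`, i.e. `c·a(b) ≥ |∂_b M_A(b)|` in the limit `S → ∞`, the REVERSE of what positive clauses
require (`c·a(b) ≤ |∂_b M_A(b)|`); so the unguarded load pins `c·a(b)` to `|∂_b(a·m)(b)|` as soon as both signs
occur and is then false for a reason that has nothing to do with the gap.  What the Feynman–Hellmann heuristic
supports, and what transport actually needs, is the floor ONLY WHERE THE CLAUSE IS POSITIVE.  This module proves
that the guarded floor suffices, with a simpler fencing argument that also drops the upper window bound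
`a(b) ≤ a(β+1)/κ` used by the sign-free lemma of v3 (`le_exp_mul_of_running_floor`, p589353):

* §1 `le_exp_mul_of_guarded_floor` — if `f` is differentiable on `[β, β+1]`, `l x · f x ≤ f' x` WHEREVER `f x > 0`,
  `l₀ ≤ l` on the window and `f(β+1) ≤ M` with `M ≥ 0`, then `f β ≤ e^{−l₀}·M`.  (If `f β ≤ 0` it is free.  If
  `f β > 0`, the function `g = e^{−l₀(x−β)} f` cannot drop below `g β` on the window: at a first contact with the
  barrier `g β − ε e^{x−β}` it is still positive, so the guarded floor makes `g' ≥ 0` there — fencing lemma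
  `image_le_of_deriv_right_lt_deriv_boundary`; hence `f β = g β ≤ g(β+1) = e^{−l₀} f(β+1)`.)
* §2 `latticeConnectedCorr_le_of_guarded_floor`, `reflAntipodalDecay_of_windowRegular_of_guardedFloor` — for the
  line: lower window regularity `κ·a(β) ≤ a(b)` + the GUARDED running floor for the two reflected antipodal clauses
  of every species (skeleton v6 `ReflSlopeFloorPos`, δ-unfolded) ⇒ reflected antipodal decay in units at rate `c·κ`
  (skeleton `ReflAntipodalDecay`, δ-unfolded), anchored at the free end by `|c(S;S)| ≤ 2‖A‖∞²` at `β + 1`.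
* §3 `guarded_of_unguarded` — the v5.1 load implies the guarded one (the re-typing is a WEAKENING).

Group-blind calculus; carries no gap content; nothing here proves the reflected slope floor, `BalabanLadder.IR`, or
the Yang–Mills mass gap (Clay); R4 closes only the conditional finite-𝕋⁴ rung `BalabanLadder.UV`.
-/

set_option autoImplicit false

noncomputable section

open MeasureTheory Filter Topology Set
open Literature.MathematicalPhysics.QuantumFieldTheory Literature.MathematicalPhysics.QuantumLattice

namespace Summit.QuantumFields.YangMills.Cruxes.IR.BetaSlopeFloor

/-! ## §1 Calculus: a floor that holds only where `f > 0` still transports an endpoint bound -/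

/-- **Transport of a guarded running floor.**  If `f` is differentiable at every point of `[β, β+1]`,
`l x · f x ≤ f' x` at every point of the window WHERE `0 < f x`, `l₀ ≤ l` on the window, and `f (β+1) ≤ M` with
`0 ≤ M`, then `f β ≤ e^{−l₀} · M`.  No sign assumption on `f`, no upper bound on `l`. -/
theorem le_exp_mul_of_guarded_floor {f : ℝ → ℝ} {β l₀ M : ℝ} {l : ℝ → ℝ}
    (hf : ∀ x ∈ Icc β (β + 1), DifferentiableAt ℝ f x)
    (hfl : ∀ x ∈ Icc β (β + 1), 0 < f x → l x * f x ≤ deriv f x)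
    (hl₀ : ∀ x ∈ Icc β (β + 1), l₀ ≤ l x) (hM : f (β + 1) ≤ M) (hM0 : 0 ≤ M) :
    f β ≤ Real.exp (-l₀) * M := by
  by_cases h0 : f β ≤ 0
  · exact h0.trans (mul_nonneg (Real.exp_pos _).le hM0)
  push Not at h0
  -- `g x = e^{-l₀ (x-β)} f x`, `u = -g`
  set E : ℝ → ℝ := fun x => Real.exp (-l₀ * (x - β)) with hE
  have hEd : ∀ x, HasDerivAt E (Real.exp (-l₀ * (x - β)) * -l₀) x := by
    intro x
    have h1 : HasDerivAt (fun y : ℝ => -l₀ * (y - β)) (-l₀) x := by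
      simpa using ((hasDerivAt_id x).sub_const β).const_mul (-l₀)
    exact h1.exp
  set u : ℝ → ℝ := fun x => -(E x * f x) with hu
  set u' : ℝ → ℝ := fun x => -(Real.exp (-l₀ * (x - β)) * -l₀ * f x + Real.exp (-l₀ * (x - β)) * deriv f x)
    with hu'
  have hud : ∀ x ∈ Icc β (β + 1), HasDerivAt u (u' x) x := fun x hx =>
    ((hEd x).mul (hf x hx).hasDerivAt).neg
  have huc : ContinuousOn u (Icc β (β + 1)) := fun x hx => (hud x hx).continuousAt.continuousWithinAt
  -- fencing against `-f β + ε e^{x - β}` for every `0 < ε` with `ε e < f β`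
  have hfence : ∀ ε : ℝ, 0 < ε → ε * Real.exp 1 < f β →
      ∀ x ∈ Icc β (β + 1), u x ≤ -f β + ε * Real.exp (x - β) := by
    intro ε hε hεe x hx
    have hB : ∀ y, HasDerivAt (fun y => -f β + ε * Real.exp (y - β)) (ε * Real.exp (y - β)) y := by
      intro y
      have h1 : HasDerivAt (fun y : ℝ => y - β) 1 y := (hasDerivAt_id y).sub_const β
      simpa using (h1.exp.const_mul ε).const_add (-f β)
    refine image_le_of_deriv_right_lt_deriv_boundary huc
      (fun y hy => (hud y (Ico_subset_Icc_self hy)).hasDerivWithinAt) ?_ hB ?_ hx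
    · show u β ≤ -f β + ε * Real.exp (β - β)
      simp only [hu, hE, sub_self, mul_zero, Real.exp_zero, one_mul, mul_one]
      linarith
    · intro y hy hcontact
      -- at a contact point `g y = f β − ε e^{y−β} > 0`, so `f y > 0`, the guarded floor applies, `g' y ≥ 0`
      have hy' : y ∈ Icc β (β + 1) := Ico_subset_Icc_self hy
      have hEpos : 0 < Real.exp (-l₀ * (y - β)) := Real.exp_pos _
      have hey : Real.exp (y - β) ≤ Real.exp 1 := Real.exp_le_exp.2 (by linarith [hy.2])
      have hgpos : 0 < E y * f y := by
        have : u y = -f β + ε * Real.exp (y - β) := hcontact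
        simp only [hu] at this
        nlinarith [mul_le_mul_of_nonneg_left hey hε.le]
      have hfpos : 0 < f y := (mul_pos_iff_of_pos_left hEpos).mp hgpos
      have hg' : 0 ≤ Real.exp (-l₀ * (y - β)) * -l₀ * f y + Real.exp (-l₀ * (y - β)) * deriv f y := by
        have key : Real.exp (-l₀ * (y - β)) * -l₀ * f y + Real.exp (-l₀ * (y - β)) * deriv f y =
            Real.exp (-l₀ * (y - β)) * (deriv f y - l₀ * f y) := by ring
        rw [key]
        refine mul_nonneg hEpos.le ?_
        have h1 := hfl y hy' hfpos
        have h2 : l₀ * f y ≤ l y * f y := mul_le_mul_of_nonneg_right (hl₀ y hy') hfpos.le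
        linarith
      have hu'le : u' y ≤ 0 := by simp only [hu']; linarith
      exact lt_of_le_of_lt hu'le (by positivity)
  -- hence `g x ≥ f β` on the window
  have hg : ∀ x ∈ Icc β (β + 1), f β ≤ E x * f x := by
    intro x hx
    by_contra hlt
    push Not at hlt
    set δ : ℝ := f β - E x * f x with hδ
    have hδ0 : 0 < δ := by rw [hδ]; linarith
    have hex : Real.exp (x - β) ≤ Real.exp 1 := Real.exp_le_exp.2 (by linarith [hx.2])
    have he0 : 0 < Real.exp 1 := Real.exp_pos 1
    set ε : ℝ := min δ (f β) / (2 * Real.exp 1) with hεdef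
    have hmin0 : 0 < min δ (f β) := lt_min hδ0 h0
    have hε : 0 < ε := by positivity
    have hε1 : ε * Real.exp 1 = min δ (f β) / 2 := by
      rw [hεdef]; field_simp
    have hεe : ε * Real.exp 1 < f β := by
      rw [hε1]; have := min_le_right δ (f β); linarith
    have h := hfence ε hε hεe x hx
    simp only [hu] at h
    have h2 : ε * Real.exp (x - β) ≤ δ / 2 := by
      calc ε * Real.exp (x - β) ≤ ε * Real.exp 1 := mul_le_mul_of_nonneg_left hex hε.le
        _ = min δ (f β) / 2 := hε1
        _ ≤ δ / 2 := by have := min_le_left δ (f β); linarith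
    -- `g x ≥ f β − ε e^{x−β} ≥ f β − δ/2 > f β − δ = g x`
    have : E x * f x ≥ f β - δ / 2 := by linarith
    rw [hδ] at this
    linarith
  -- at `x = β + 1`
  have h1 := hg (β + 1) ⟨by linarith, le_rfl⟩
  have hE1 : E (β + 1) = Real.exp (-l₀) := by simp only [hE]; ring_nf
  rw [hE1] at h1
  exact h1.trans (mul_le_mul_of_nonneg_left hM (Real.exp_pos _).le)

/-! ## §2 The line: window regularity + GUARDED running reflected floor ⇒ reflected antipodal decay in units -/

section Line

variable {G : Type} [Group G] [TopologicalSpace G] [IsTopologicalGroup G] [CompactSpace G]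
  [MeasurableSpace G] [BorelSpace G]

/-- A guarded running floor (only where the correlator is positive) for a correlator of two bounded measurable
observables on a unit window, with lower window regularity `κ a(β) ≤ a(b)`, transports to the frozen-unit decay
`c_β ≤ e^{K} e^{−cκ a(β) s} · 2 C_A C_B` — no sign of the correlator and no upper bound on the unit needed. -/
theorem latticeConnectedCorr_le_of_guarded_floor (r : LatticeRep G) (S : ℕ) [NeZero S]
    {A B : LGConfig 4 G → ℝ} (hAm : Measurable A) (hBm : Measurable B) {CA CB : ℝ}
    (hA : ∀ U, |A U| ≤ CA) (hB : ∀ U, |B U| ≤ CB) (n : ℕ) {a : ℝ → ℝ} {β c κ K s : ℝ}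
    (hc : 0 ≤ c) (hs : 0 ≤ s) (hκa : ∀ b : ℝ, β ≤ b → b ≤ β + 1 → κ * a β ≤ a b)
    (hfl : ∀ b : ℝ, β ≤ b → b ≤ β + 1 → 0 < latticeConnectedCorr r.ρ b S A B n →
      (c * a b * s - K) * latticeConnectedCorr r.ρ b S A B n ≤
        deriv (fun b' => latticeConnectedCorr r.ρ b' S A B n) b) :
    latticeConnectedCorr r.ρ β S A B n ≤
      Real.exp K * Real.exp (-(c * κ * a β * s)) * (2 * (CA * CB)) := by
  have h2 : latticeConnectedCorr r.ρ (β + 1) S A B n ≤ 2 * (CA * CB) :=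
    (le_abs_self _).trans (WilsonBlockHeatBath.abs_latticeConnectedCorr_le_two_mul r (β + 1) S hA hB n)
  have hCA0 : 0 ≤ CA := le_trans (abs_nonneg _) (hA fun _ => 1)
  have hCB0 : 0 ≤ CB := le_trans (abs_nonneg _) (hB fun _ => 1)
  have h := le_exp_mul_of_guarded_floor (f := fun b' => latticeConnectedCorr r.ρ b' S A B n)
    (l := fun b => c * a b * s - K) (l₀ := c * κ * a β * s - K)
    (fun x _ => differentiableAt_latticeConnectedCorr r S hAm hBm hA hB n x)
    (fun x hx hpos => hfl x hx.1 hx.2 hpos)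
    (fun x hx => by
      have := mul_le_mul_of_nonneg_right
        (mul_le_mul_of_nonneg_left (hκa x hx.1 hx.2) hc) hs
      linarith)
    h2 (by positivity)
  have hexp : Real.exp (-(c * κ * a β * s - K)) = Real.exp K * Real.exp (-(c * κ * a β * s)) := by
    rw [← Real.exp_add]; ring_nf
  rw [hexp] at h
  exact h

/-- **Window regularity + GUARDED running reflected slope floor ⇒ reflected antipodal decay in units** (skeleton
v6: `WindowRegular`, `ReflSlopeFloorPos`, `ReflAntipodalDecay` δ-unfolded).  If `κ·a(β) ≤ a(b)` on the unit windows
(`β ≥ β₂ʷ`) and every species `A` has a constant `K_A` such that, for `b ∈ [β, β+1]`, `β ≥ β₂`, `S ≥ S₁ β`, the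
running floor `(c·a(b)·S − K_A)·R_b ≤ ∂_b R_b` holds for each of the two reflected antipodal clauses
`R = c_{ΘA,A}(S;S)`, `c_{A,ΘA}(S;S)` AT THE POINTS WHERE THAT CLAUSE IS POSITIVE, then both clauses decay at the
antipode in the frozen unit: `R_β ≤ e^{K_A}·2‖A‖∞²·e^{−(cκ)·a(β)·S}` for `β ≥ max β₂ β₂ʷ`, `S ≥ S₁ β`. -/
theorem reflAntipodalDecay_of_windowRegular_of_guardedFloor (r : LatticeRep G) (a : ℝ → ℝ)
    (hW : ∃ κ β₂ : ℝ, 0 < κ ∧ ∀ β : ℝ, β₂ ≤ β → ∀ b : ℝ, β ≤ b → b ≤ β + 1 → κ * a β ≤ a b)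
    (h : ∃ (c β₂ : ℝ) (S₁ : ℝ → ℕ), 0 < c ∧ ∀ A : YMSpecies G, ∃ K : ℝ, ∀ β : ℝ, β₂ ≤ β →
      ∀ S : ℕ, S₁ β ≤ S → ∀ b : ℝ, β ≤ b → b ≤ β + 1 →
        (0 < latticeConnectedCorr r.ρ b (2 * S + 1) A.timeReflect.F A.F S →
          (c * a b * S - K) * latticeConnectedCorr r.ρ b (2 * S + 1) A.timeReflect.F A.F S ≤
            deriv (fun b' => latticeConnectedCorr r.ρ b' (2 * S + 1) A.timeReflect.F A.F S) b) ∧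
        (0 < latticeConnectedCorr r.ρ b (2 * S + 1) A.F A.timeReflect.F S →
          (c * a b * S - K) * latticeConnectedCorr r.ρ b (2 * S + 1) A.F A.timeReflect.F S ≤
            deriv (fun b' => latticeConnectedCorr r.ρ b' (2 * S + 1) A.F A.timeReflect.F S) b)) :
    ∃ (c₁ β₂ : ℝ) (S₁ : ℝ → ℕ), 0 < c₁ ∧ ∀ A : YMSpecies G, ∃ C : ℝ, ∀ β : ℝ, β₂ ≤ β →
      ∀ S : ℕ, S₁ β ≤ S →
        latticeConnectedCorr r.ρ β (2 * S + 1) A.timeReflect.F A.F S ≤ C * Real.exp (-(c₁ * a β * S)) ∧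
          latticeConnectedCorr r.ρ β (2 * S + 1) A.F A.timeReflect.F S ≤
            C * Real.exp (-(c₁ * a β * S)) := by
  obtain ⟨κ, βw, hκ, hW⟩ := hW
  obtain ⟨c, β₂, S₁, hc, h⟩ := h
  refine ⟨c * κ, max β₂ βw, S₁, mul_pos hc hκ, fun A => ?_⟩
  obtain ⟨K, hK⟩ := h A
  obtain ⟨CA, hCA⟩ := A.bounded
  have hCA' : ∀ U, |A.timeReflect.F U| ≤ CA := fun U => by simpa using hCA (cfgReflect U)
  refine ⟨Real.exp K * (2 * (CA * CA)), fun β hβ S hS => ?_⟩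
  have hβ₂ : β₂ ≤ β := (le_max_left _ _).trans hβ
  have hβw : βw ≤ β := (le_max_right _ _).trans hβ
  have hκa : ∀ b : ℝ, β ≤ b → b ≤ β + 1 → κ * a β ≤ a b := fun b hb1 hb2 => hW β hβw b hb1 hb2
  have e1 : Real.exp K * Real.exp (-(c * κ * a β * S)) * (2 * (CA * CA)) =
      Real.exp K * (2 * (CA * CA)) * Real.exp (-(c * κ * a β * S)) := by ring
  constructor
  · have hres := latticeConnectedCorr_le_of_guarded_floor r (2 * S + 1) A.timeReflect.measurable
      A.measurable hCA' hCA S (a := a) (β := β) (c := c) (κ := κ) (K := K) (s := S)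
      hc.le (Nat.cast_nonneg S) hκa
      (fun b hb1 hb2 hpos => (hK β hβ₂ S hS b hb1 hb2).1 hpos)
    rw [e1] at hres
    exact hres
  · have hres := latticeConnectedCorr_le_of_guarded_floor r (2 * S + 1) A.measurable
      A.timeReflect.measurable hCA hCA' S (a := a) (β := β) (c := c) (κ := κ) (K := K) (s := S)
      hc.le (Nat.cast_nonneg S) hκa
      (fun b hb1 hb2 hpos => (hK β hβ₂ S hS b hb1 hb2).2 hpos)
    rw [e1] at hres
    exact hres

/-! ## §3 The re-typing is a weakening -/

/-- The unguarded running floor of skeleton v3–v5.1 (`ReflSlopeFloor`, δ-unfolded) implies the guarded one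
(`ReflSlopeFloorPos`, δ-unfolded), with the same constants. -/
theorem guarded_of_unguarded (r : LatticeRep G) (a : ℝ → ℝ)
    (h : ∃ (c β₂ : ℝ) (S₁ : ℝ → ℕ), 0 < c ∧ ∀ A : YMSpecies G, ∃ K : ℝ, ∀ β : ℝ, β₂ ≤ β →
      ∀ S : ℕ, S₁ β ≤ S → ∀ b : ℝ, β ≤ b → b ≤ β + 1 →
        (c * a b * S - K) * latticeConnectedCorr r.ρ b (2 * S + 1) A.timeReflect.F A.F S ≤
            deriv (fun b' => latticeConnectedCorr r.ρ b' (2 * S + 1) A.timeReflect.F A.F S) b ∧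
          (c * a b * S - K) * latticeConnectedCorr r.ρ b (2 * S + 1) A.F A.timeReflect.F S ≤
            deriv (fun b' => latticeConnectedCorr r.ρ b' (2 * S + 1) A.F A.timeReflect.F S) b) :
    ∃ (c β₂ : ℝ) (S₁ : ℝ → ℕ), 0 < c ∧ ∀ A : YMSpecies G, ∃ K : ℝ, ∀ β : ℝ, β₂ ≤ β →
      ∀ S : ℕ, S₁ β ≤ S → ∀ b : ℝ, β ≤ b → b ≤ β + 1 →
        (0 < latticeConnectedCorr r.ρ b (2 * S + 1) A.timeReflect.F A.F S →
          (c * a b * S - K) * latticeConnectedCorr r.ρ b (2 * S + 1) A.timeReflect.F A.F S ≤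
            deriv (fun b' => latticeConnectedCorr r.ρ b' (2 * S + 1) A.timeReflect.F A.F S) b) ∧
        (0 < latticeConnectedCorr r.ρ b (2 * S + 1) A.F A.timeReflect.F S →
          (c * a b * S - K) * latticeConnectedCorr r.ρ b (2 * S + 1) A.F A.timeReflect.F S ≤
            deriv (fun b' => latticeConnectedCorr r.ρ b' (2 * S + 1) A.F A.timeReflect.F S) b) := by
  obtain ⟨c, β₂, S₁, hc, h⟩ := h
  refine ⟨c, β₂, S₁, hc, fun A => ?_⟩
  obtain ⟨K, hK⟩ := h A
  exact ⟨K, fun β hβ S hS b hb1 hb2 =>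
    ⟨fun _ => (hK β hβ S hS b hb1 hb2).1, fun _ => (hK β hβ S hS b hb1 hb2).2⟩⟩

end Line

end Summit.QuantumFields.YangMills.Cruxes.IR.BetaSlopeFloor

end
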